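import Summits.BirchSwinnertonDyer.Statement
import Literature.NumberTheory.EllipticCurves.Selmer

/-!
# BirchSwinnertonDyer / SelmerRank — a finite `p`-primary Ш has `ℤ_p`-corank `0`

Route `BirchSwinnertonDyer/SelmerRank`, items `stmt-BirchSwinnertonDyer-0480` (r2) and
`stmt-BirchSwinnertonDyer-0133` (same signature): if `Ш(E/ℚ)[p^∞]` is finite then
`shaCorank E p = 0`, where `shaCorank = Literature.zpCorank Ш[p^∞] p` and
`Literature.zpCorank A p = dim_{𝔽_p} A[p] − dim_{𝔽_p} A/pA` (Greenberg 1999, §1).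

The content is pure finite-group algebra, proved here for an arbitrary finite abelian group `A`
(`Literature.BSD.zpCorank_eq_zero_of_finite`): for the endomorphism `φ = p • ·` of the finite group `A`,
`|ker φ| · |im φ| = |A| = |A / im φ| · |im φ|`, so `|A[p]| = |A/pA|`; both are finite
`𝔽_p`-vector spaces, so `p ^ dim A[p] = p ^ dim A/pA` and the dimensions agree. Neither
`[W.IsElliptic]` nor the primality of `p` beyond `ZMod p` being a field is used.
-/

namespace Literature.BSD

/-- For a finite abelian group `A` and a prime `p`, `dim_{𝔽_p} A[p] = dim_{𝔽_p} A/pA`, hence the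
`ℤ_p`-corank formula `Literature.zpCorank A p = dim A[p] − dim A/pA` vanishes (Greenberg 1999, §1: a
finite `p`-primary group has corank `0`). Proof: `|ker (p•)| = |A| / |im (p•)| = |A / pA|` and
`Nat.card = p ^ finrank` on both sides. [folklore] -/
theorem zpCorank_eq_zero_of_finite (A : Type*) [AddCommGroup A] [Finite A] (p : ℕ)
    [hp : Fact p.Prime] : Literature.NumberTheory.EllipticCurves.zpCorank A p = 0 := by
  classical
  unfold Literature.NumberTheory.EllipticCurves.zpCorank
  letI : Module (ZMod p) (AddSubgroup.torsionBy A (p : ℤ)) := AddSubgroup.torsionBy.zmodModule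
  set φ : A →+ A := zsmulAddGroupHom (p : ℤ) with hφ
  have hker : ∀ x, x ∈ φ.ker ↔ x ∈ (AddSubgroup.torsionBy A (p : ℤ)) := by
    intro x
    simp [hφ, AddMonoidHom.mem_ker, Submodule.mem_torsionBy_iff]
  have hrange : ∀ x, x ∈ φ.range ↔
      x ∈ (LinearMap.range (LinearMap.lsmul ℤ A p)).toAddSubgroup := by
    intro x
    simp [hφ, AddMonoidHom.mem_range, LinearMap.mem_range]
  have hkerEq : φ.ker = (AddSubgroup.torsionBy A (p : ℤ)) := AddSubgroup.ext hker
  have hrangeEq : φ.range = (LinearMap.range (LinearMap.lsmul ℤ A p)).toAddSubgroup :=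
    AddSubgroup.ext hrange
  have h1 : Nat.card A = Nat.card (A ⧸ φ.ker) * Nat.card φ.ker :=
    AddSubgroup.card_eq_card_quotient_mul_card_addSubgroup _
  have h2 : Nat.card (A ⧸ φ.ker) = Nat.card φ.range :=
    Nat.card_congr (QuotientAddGroup.quotientKerEquivRange φ).toEquiv
  have h3 : Nat.card A = Nat.card (A ⧸ φ.range) * Nat.card φ.range :=
    AddSubgroup.card_eq_card_quotient_mul_card_addSubgroup _
  have hpos : 0 < Nat.card φ.range := Nat.card_pos
  have hcard : Nat.card φ.ker = Nat.card (A ⧸ φ.range) := by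
    rw [h2] at h1
    have := h1.symm.trans h3
    have : Nat.card φ.ker * Nat.card φ.range = Nat.card (A ⧸ φ.range) * Nat.card φ.range := by
      rw [mul_comm]; exact this
    exact Nat.eq_of_mul_eq_mul_right hpos this
  have hcardK : Nat.card (AddSubgroup.torsionBy A (p : ℤ)) = Nat.card (ModN A p) := by
    rw [← hkerEq, hcard, hrangeEq]
    rfl
  haveI : Module.Finite (ZMod p) (AddSubgroup.torsionBy A (p : ℤ)) := Module.Finite.of_finite
  haveI : Finite (ModN A p) :=
    Finite.of_surjective _ (Submodule.mkQ_surjective (LinearMap.range (LinearMap.lsmul ℤ A p)))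
  haveI : Module.Finite (ZMod p) (ModN A p) := Module.Finite.of_finite
  have e1 := Module.natCard_eq_pow_finrank (K := ZMod p) (V := (AddSubgroup.torsionBy A (p : ℤ)))
  have e2 := Module.natCard_eq_pow_finrank (K := ZMod p) (V := ModN A p)
  rw [Nat.card_zmod] at e1 e2
  have : Module.finrank (ZMod p) (AddSubgroup.torsionBy A (p : ℤ)) = Module.finrank (ZMod p) (ModN A p) :=
    Nat.pow_right_injective hp.out.two_le (e1.symm.trans (hcardK.trans e2))
  omega

open WeierstrassCurve in
/-- Settles `stmt-BirchSwinnertonDyer-0480` / `stmt-BirchSwinnertonDyer-0133`: if the `p`-primary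
part `Ш(E/ℚ)[p^∞]` of the Tate–Shafarevich group is finite, its `ℤ_p`-corank `shaCorank E p` is
`0` (Greenberg 1999, §1). Immediate from `zpCorank_eq_zero_of_finite`. [folklore] -/
theorem shaCorank_eq_zero_of_finite :
    ∀ (W : WeierstrassCurve ℚ) [W.IsElliptic] (p : ℕ) [Fact p.Prime],
      Finite ↥(AddCommGroup.primaryComponent W.sha p) → W.shaCorank p = 0 := by
  intro W _ p _ _
  exact zpCorank_eq_zero_of_finite _ p

end Literature.BSD
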